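import Summits.CriticalPhenomena.PercolationContinuityZ3.Theorems.PercNearOneGluingNoHeavyLowerTailAttachedChampionObserverExchange
import HarnessLib

/-!
# `NoHeavyLowerTail` (stmt-CriticalPhenomena-4575) — the hanging-vertex exchange: the good-block case of the last open leaf inequality of
# the relay-neighboured-set wall

Support file (prover `prim-hp-6`, hull-port cell, observer-set / OES technique; `--supports stmt-CriticalPhenomena-4575`).  No definitions,
no named facts, no sorries.  Notation: `μ_w = prodBernoulli w` on `Fin n`, relays `A`, level `j`, `I_w(x) = μ_w{|π(x)| ≤ j}` (lightness).

Context (crux evidence HP6-MEMO3-SETAP1.md §7–9).  Along prim-lf-3's exploration of a relay-neighboured Steiner set `U` with the `c`-designation, the wall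
`CS_H(U, c)` for a champion `c` with light members reduces, by an exact identity, to lf-3's (proved) stage inequality plus ONE leaf inequality per stage:
in the state where the member `u` has just been glued onto its port `q`,
  `DIFF := μ(c ↔ U, |π(c)| ≤ j) − μ(c ↔ U, |π(q)| ≤ j) ≤ 0`,
and since on `{c ↔ q}` the two clusters coincide, `DIFF = μ(v ↔ c, c light) − μ(v ↔ c, q light)` with `v` the other member ("`c` hangs on `v`").
Census: `DIFF ≤ 0` at all 11 187 stages tested (champion `c`, light members, K₀- or lf-3-greedy order).

* `SetPort.real_hang_light_le` — **hanging-vertex exchange (the good-block case):** for ANY weights and vertices `v, c, q` with `I_w(c) ≤ I_w(q)`: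
  `μ_w(v ↔ c, |π(c)| ≤ j) ≤ μ_w(v ↔ c, |π(q)| ≤ j)`  — hanging `v` on `c` cannot reverse a lightness comparison that `c` already loses.
  Proof: after cancelling `{both light}` it is `μ(v↔c, c light, q heavy) ≤ μ(v↔c, c heavy, q light)`, which is the tree's observer row
  `AttachedChampionObserverExchange.observer_row` (van den Berg–Häggström–Kahn Thm 1.5) multiplied out with `μ(c light, q heavy) ≤ μ(c heavy, q light)` (`⟺ I(c) ≤ I(q)`).
So the leaf inequality holds whenever the freshly glued block `u ∪ q` is at least as light as `c` in the current state (≈ 72 % of the stages in the census); the remaining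
"bad-block" case (`I(u ∪ q) < I(c)`, where the conditioning on `{v ↔ c}` must be used) is the residual of the relay-neighboured-set wall recorded in the memo.
-/

noncomputable section

namespace Summit.CriticalPhenomena.PercolationContinuityZ3.Theorems

open MeasureTheory Set Literature.Probability.LatticeModels Literature.Probability.Percolation
open scoped Classical BigOperators

variable {n : ℕ}

namespace SetPort

/-- **Hanging-vertex exchange.**  For any weights `w`, relay set `A`, level `j` and vertices `v, c, q` with `I_w(c) ≤ I_w(q)`:
`μ_w(v ↔ c ∧ |π(c)| ≤ j) ≤ μ_w(v ↔ c ∧ |π(q)| ≤ j)`.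
[cite: VandenbergHaggstromKahn2005, Thm. 1.5 (p. 7) — via `AttachedChampionObserverExchange.observer_row`] -/
theorem real_hang_light_le (w : Sym2 (Fin n) → unitInterval) (A : Finset (Fin n)) (v c q : Fin n) (j : ℕ)
    (hle : (prodBernoulli w).real {ω : BondConfig (Fin n) | (A.filter fun x => ω ∈ openConn c x).card ≤ j} ≤
      (prodBernoulli w).real {ω : BondConfig (Fin n) | (A.filter fun x => ω ∈ openConn q x).card ≤ j}) :
    (prodBernoulli w).real ((openConn v c : Set (BondConfig (Fin n))) ∩
        {ω | (A.filter fun x => ω ∈ openConn c x).card ≤ j}) ≤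
      (prodBernoulli w).real ((openConn v c : Set (BondConfig (Fin n))) ∩
        {ω | (A.filter fun x => ω ∈ openConn q x).card ≤ j}) := by
  set μ := prodBernoulli w with hμ
  set Lc : Set (BondConfig (Fin n)) := {ω | (A.filter fun x => ω ∈ openConn c x).card ≤ j} with hLc
  set Lq : Set (BondConfig (Fin n)) := {ω | (A.filter fun x => ω ∈ openConn q x).card ≤ j} with hLq
  set H : Set (BondConfig (Fin n)) := (openConn v c : Set (BondConfig (Fin n))) with hH
  -- the four mixed events
  set Ep : Set (BondConfig (Fin n)) := {ω | (A.filter fun x => ω ∈ openConn c x).card ≤ j ∧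
    j < (A.filter fun x => ω ∈ openConn q x).card} with hEp            -- c light, q heavy
  set Em : Set (BondConfig (Fin n)) := {ω | j < (A.filter fun x => ω ∈ openConn c x).card ∧
    (A.filter fun x => ω ∈ openConn q x).card ≤ j} with hEm            -- c heavy, q light
  have hmeas : ∀ s : Set (BondConfig (Fin n)), MeasurableSet s := fun _ => MeasurableSet.of_discrete
  -- splitting lightness events along the other vertex
  have sc : ∀ X : Set (BondConfig (Fin n)), μ.real (X ∩ Lc) = μ.real (X ∩ (Lc ∩ Lq)) + μ.real (X ∩ Ep) := by
    intro X
    have e1 : X ∩ (Lc ∩ Lq) = (X ∩ Lc) ∩ Lq := by rw [Set.inter_assoc]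
    have e2 : X ∩ Ep = (X ∩ Lc) \ Lq := by
      ext ω; simp only [hEp, hLc, hLq, mem_inter_iff, mem_setOf_eq, mem_sdiff, not_le]; tauto
    rw [e1, e2, measureReal_inter_add_sdiff (hmeas Lq)]
  have sq : ∀ X : Set (BondConfig (Fin n)), μ.real (X ∩ Lq) = μ.real (X ∩ (Lc ∩ Lq)) + μ.real (X ∩ Em) := by
    intro X
    have e1 : X ∩ (Lc ∩ Lq) = (X ∩ Lq) ∩ Lc := by
      rw [Set.inter_comm Lc Lq, Set.inter_assoc]
    have e2 : X ∩ Em = (X ∩ Lq) \ Lc := by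
      ext ω; simp only [hEm, hLc, hLq, mem_inter_iff, mem_setOf_eq, mem_sdiff, not_le]; tauto
    rw [e1, e2, measureReal_inter_add_sdiff (hmeas Lc)]
  -- unconditional comparison: μ(Ep) ≤ μ(Em)
  have h0 : μ.real Ep ≤ μ.real Em := by
    have a := sc Set.univ
    have b := sq Set.univ
    simp only [Set.univ_inter] at a b
    rw [hμ] at a b
    linarith [hle]
  -- the observer row: μ(H ∩ Ep) · μ(Em) ≤ μ(H ∩ Em) · μ(Ep)
  have row := AttachedChampionObserverExchange.observer_row w A v c q j
  have hrow : μ.real (H ∩ Ep) * μ.real Em ≤ μ.real (H ∩ Em) * μ.real Ep := by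
    rw [hμ, hH, hEp, hEm]; exact row
  -- conclude μ(H ∩ Ep) ≤ μ(H ∩ Em)
  have key : μ.real (H ∩ Ep) ≤ μ.real (H ∩ Em) := by
    by_cases hz : μ.real Em = 0
    · have h1 : μ.real Ep = 0 := le_antisymm (hz ▸ h0) measureReal_nonneg
      have h2 : μ.real (H ∩ Ep) ≤ μ.real Ep := measureReal_mono Set.inter_subset_right (measure_ne_top _ _)
      linarith [h2, h1, (measureReal_nonneg : 0 ≤ μ.real (H ∩ Em))]
    · have hpos : 0 < μ.real Em := lt_of_le_of_ne measureReal_nonneg (Ne.symm hz)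
      have h3 : μ.real (H ∩ Em) * μ.real Ep ≤ μ.real (H ∩ Em) * μ.real Em :=
        mul_le_mul_of_nonneg_left h0 measureReal_nonneg
      nlinarith [hrow, h3, hpos]
  rw [sc H, sq H]
  linarith

end SetPort

end Summit.CriticalPhenomena.PercolationContinuityZ3.Theorems

end
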